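import Literature.MathematicalPhysics.QuantumManyBody.JelliumSliceAlgebra
import HarnessLib

/-!
# The one-body term through the condensate: `m = PmP + (PmQ + QmP) + QmQ` on a fibre

Topic `Literature/MathematicalPhysics/QuantumManyBody` (the charged Bose gas, `JelliumBoseGas.foldyLaw`).
Step (2b) of the first-quantized route to [LiebSolovej2001, Thm. 9.2]. In [LiebSolovej2001, §5] the
background term `-ρ∑ⱼ∫w_{r,R}(xⱼ,y)dy = -ρ∑ⱼ m(xⱼ)`, `m(x) = ∫w(x,y)dy`, is written
`-ρℓ³∑_{pq}ŵ_{0p,0q}a*_pa_q` and split according to `p, q = 0` or `≠ 0`: the `ŵ_{00,00}` piece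
(`p = q = 0`, proportional to `n̂₀`), the pieces `ŵ_{p0,00}` (one index `≠ 0`) and `ŵ_{p0,q0}`
(both `≠ 0`, bounded by `sup m · n̂₊`, Lemma 5.3). In first quantization, on the fibre of the `j`-th
variable through `X`, with `P = (PⱼΨ)(X)` and `Q(y) = (QⱼΨ)(X; xⱼ ↦ y)`:

`∫_Λ m(y)|Ψ(X;xⱼ↦y)|²dy = |P|²∫_Λ m + 2Re( P̄ ∫_Λ m Q ) + ∫_Λ m|Q|²`

(`setIntegral_cell_mul_normSq_update`), together with the bound of the cross term
`|2Re(P̄∫mQ)| ≤ 2|P|∫|m||Q|` (`abs_cross_le`).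

## References

* [LiebSolovej2001] E. H. Lieb, J. P. Solovej, Commun. Math. Phys. 217 (2001) 127–163, §5
  (decomposition of (5.?) by the number of zero indices; Lemma 5.3) (arXiv:cond-mat/0007425, p. 11).
-/

noncomputable section

open MeasureTheory Set Filter Real Complex
open scoped ENNReal NNReal Topology ComplexConjugate

namespace Literature.MathematicalPhysics.QuantumManyBody.JelliumBoseGas

open BoseGas

variable {n : ℕ} {ℓ : ℝ}

/-- A bounded measurable real function is integrable on the cell. [folklore] -/
theorem integrableOn_cell_of_bounded {m : Space → ℝ} (hm : Measurable m) {M : ℝ}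
    (hM : ∀ y, |m y| ≤ M) (ℓ : ℝ) : IntegrableOn m (cell ℓ) := by
  haveI := isFiniteMeasure_restrict_cell ℓ
  refine Integrable.mono' (integrable_const M) hm.aestronglyMeasurable (Eventually.of_forall fun y => ?_)
  rw [Real.norm_eq_abs]; exact hM y

/-- The fibre of `QⱼΨ` is continuous in the fibre variable. [folklore] -/
theorem continuous_sliceFluct_update (ℓ : ℝ) (j : Fin n) {Ψ : Config n → ℂ} (hΨ : Continuous Ψ)
    (X : Config n) : Continuous fun y : Space => sliceFluct ℓ j Ψ (Function.update X j y) := by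
  simp_rw [sliceFluct_update]
  exact (hΨ.comp (continuous_const.update j continuous_id)).sub continuous_const

/-- **The one-body term on a fibre, split by the condensate** [LiebSolovej2001, §5]: for `m`
measurable and bounded, `Ψ` continuous, `ℓ > 0`,
`∫_Λ m(y)|Ψ(X;xⱼ↦y)|²dy = |PⱼΨ(X)|² ∫_Λ m + 2Re( conj(PⱼΨ(X)) ∫_Λ m(y)(QⱼΨ)(X;xⱼ↦y)dy ) + ∫_Λ m|QⱼΨ|²`
(the `ŵ_{00}`, `ŵ_{p0,00}` and `ŵ_{p0,q0}` pieces of the background term).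
[cite: LiebSolovej2001, §5] -/
theorem setIntegral_cell_mul_normSq_update {m : Space → ℝ} (hm : Measurable m) {M : ℝ}
    (hM : ∀ y, |m y| ≤ M) (j : Fin n) {Ψ : Config n → ℂ} (hΨ : Continuous Ψ) (X : Config n) :
    ∫ y in cell ℓ, m y * ‖Ψ (Function.update X j y)‖ ^ 2 =
      ‖sliceMean ℓ j Ψ X‖ ^ 2 * (∫ y in cell ℓ, m y) +
        2 * (conj (sliceMean ℓ j Ψ X) * ∫ y in cell ℓ, (m y : ℂ) * sliceFluct ℓ j Ψ (Function.update X j y)).re +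
        ∫ y in cell ℓ, m y * ‖sliceFluct ℓ j Ψ (Function.update X j y)‖ ^ 2 := by
  haveI := isFiniteMeasure_restrict_cell ℓ
  set P : ℂ := sliceMean ℓ j Ψ X with hP
  set Q : Space → ℂ := fun y => sliceFluct ℓ j Ψ (Function.update X j y) with hQ
  -- pointwise expansion
  have hpt : ∀ y, m y * ‖Ψ (Function.update X j y)‖ ^ 2 =
      ‖P‖ ^ 2 * m y + 2 * (m y * (conj P * Q y).re) + m y * ‖Q y‖ ^ 2 := by
    intro y
    have e : Ψ (Function.update X j y) = P + Q y := by
      rw [hQ]; simp only; rw [sliceFluct_update, hP]; ring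
    -- `|a + b|² = |a|² + |b|² + 2Re(ā b)` (cf. `BoseGas.norm_add_sq_complex`)
    have hsq : ‖P + Q y‖ ^ 2 = ‖P‖ ^ 2 + ‖Q y‖ ^ 2 + 2 * (conj P * Q y).re := by
      rw [← Complex.normSq_eq_norm_sq, ← Complex.normSq_eq_norm_sq, ← Complex.normSq_eq_norm_sq,
        Complex.normSq_add]
      congr 1
      rw [← Complex.conj_re (P * conj (Q y)), map_mul, Complex.conj_conj]
    rw [e, hsq]; ring
  -- integrability of the pieces
  have hQc : Continuous Q := continuous_sliceFluct_update ℓ j hΨ X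
  obtain ⟨C, hC⟩ := (isCompact_closedBox ℓ).exists_bound_of_continuousOn hQc.continuousOn
  have hQb : ∀ y ∈ cell ℓ, ‖Q y‖ ≤ C := fun y hy => hC y (cell_subset_closedBox ℓ hy)
  have hmi : IntegrableOn m (cell ℓ) := integrableOn_cell_of_bounded hm hM ℓ
  have h1 : IntegrableOn (fun y => ‖P‖ ^ 2 * m y) (cell ℓ) := hmi.const_mul _
  have hcrossC : IntegrableOn (fun y => (m y : ℂ) * Q y) (cell ℓ) := by
    refine Integrable.mono' (integrable_const (M * C)) ?_ ?_
    · exact ((Complex.measurable_ofReal.comp hm).mul hQc.measurable).aestronglyMeasurable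
    · refine (ae_restrict_iff' (measurableSet_cell ℓ)).2 (Eventually.of_forall fun y hy => ?_)
      rw [norm_mul, Complex.norm_real, Real.norm_eq_abs]
      exact mul_le_mul (hM y) (hQb y hy) (norm_nonneg _) ((abs_nonneg _).trans (hM y))
  have h2 : IntegrableOn (fun y => 2 * (m y * (conj P * Q y).re)) (cell ℓ) := by
    have h : IntegrableOn (fun y => (conj P * ((m y : ℂ) * Q y)).re) (cell ℓ) :=
      (hcrossC.const_mul (conj P)).re
    refine (h.const_mul 2).congr (Eventually.of_forall fun y => ?_)
    simp only
    congr 1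
    rw [show conj P * ((m y : ℂ) * Q y) = (m y : ℂ) * (conj P * Q y) by ring, Complex.re_ofReal_mul]
  have h3 : IntegrableOn (fun y => m y * ‖Q y‖ ^ 2) (cell ℓ) := by
    refine Integrable.mono' (integrable_const (M * C ^ 2)) ?_ ?_
    · exact (hm.mul (hQc.norm.pow 2).measurable).aestronglyMeasurable
    · refine (ae_restrict_iff' (measurableSet_cell ℓ)).2 (Eventually.of_forall fun y hy => ?_)
      rw [Real.norm_eq_abs, abs_mul, abs_of_nonneg (sq_nonneg ‖Q y‖)]
      exact mul_le_mul (hM y) (pow_le_pow_left₀ (norm_nonneg _) (hQb y hy) 2) (sq_nonneg _)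
        ((abs_nonneg _).trans (hM y))
  -- integrate
  have h12 : IntegrableOn (fun y => ‖P‖ ^ 2 * m y + 2 * (m y * (conj P * Q y).re)) (cell ℓ) := h1.add h2
  simp_rw [hpt]
  rw [integral_add h12 h3, integral_add h1 h2, integral_const_mul, integral_const_mul]
  congr 2
  -- the cross term: `∫ m Re(P̄Q) = Re(P̄ ∫ mQ)`
  have e : ∀ y, m y * (conj P * Q y).re = ((conj P) * ((m y : ℂ) * Q y)).re := by
    intro y
    rw [show conj P * ((m y : ℂ) * Q y) = (m y : ℂ) * (conj P * Q y) by ring, Complex.re_ofReal_mul]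
  simp_rw [e]
  have hre := Complex.reCLM.integral_comp_comm (hcrossC.const_mul (conj P))
  simp only [Complex.reCLM_apply] at hre
  rw [hre, integral_const_mul]

/-- **The cross term is controlled by `|PⱼΨ|` and `∫|m||QⱼΨ|`**:
`|2Re(conj(P) ∫_Λ m Q)| ≤ 2|P| ∫_Λ |m||Q|`. [cite: LiebSolovej2001, §5 (Lemma 5.6 mechanism)] -/
theorem abs_cross_le (m : Space → ℝ) (j : Fin n) (Ψ : Config n → ℂ) (X : Config n) :
    |2 * (conj (sliceMean ℓ j Ψ X) * ∫ y in cell ℓ, (m y : ℂ) * sliceFluct ℓ j Ψ (Function.update X j y)).re| ≤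
      2 * ‖sliceMean ℓ j Ψ X‖ * ∫ y in cell ℓ, |m y| * ‖sliceFluct ℓ j Ψ (Function.update X j y)‖ := by
  have h1 : |(conj (sliceMean ℓ j Ψ X) *
      ∫ y in cell ℓ, (m y : ℂ) * sliceFluct ℓ j Ψ (Function.update X j y)).re| ≤
      ‖sliceMean ℓ j Ψ X‖ * ‖∫ y in cell ℓ, (m y : ℂ) * sliceFluct ℓ j Ψ (Function.update X j y)‖ := by
    refine (Complex.abs_re_le_norm _).trans ?_
    rw [norm_mul, Complex.norm_conj]
  have h2 : ‖∫ y in cell ℓ, (m y : ℂ) * sliceFluct ℓ j Ψ (Function.update X j y)‖ ≤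
      ∫ y in cell ℓ, |m y| * ‖sliceFluct ℓ j Ψ (Function.update X j y)‖ := by
    refine (norm_integral_le_integral_norm _).trans (le_of_eq ?_)
    refine integral_congr_ae (Eventually.of_forall fun y => ?_)
    simp only [norm_mul, Complex.norm_real, Real.norm_eq_abs]
  rw [abs_mul, abs_two, mul_assoc]
  exact mul_le_mul_of_nonneg_left (h1.trans (mul_le_mul_of_nonneg_left h2 (norm_nonneg _))) zero_le_two

end Literature.MathematicalPhysics.QuantumManyBody.JelliumBoseGas
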